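import Mathlib
import HarnessLib

/-!
# Flight bookkeeping for discretely self-similar (DSS) lattice orbits: flight times
# `t_j = t⋆ - t⋆e^{-jT}`, local time `e^{jT}(t - t_j)`, flight index `⌊log(t⋆/(t⋆-t))/T⌋`,
# and the scalar identities of the rescaling `λ = g e^{T}` (cell harvest/h2-tao-ladder, seat p2;
# support for K1(1) = `TaoLadderRungTwoBreak.NoSurvivingDSSOne`, stmt-NavierStokesRegularity-20205)

Elementary real-analysis lemmas (no lattice content) used by
`DSSOneShift.exists_dssOrbit_of_oneShiftDatum` (module
`TaoLadderRungTwoBreakDSSOrbitOfOneShiftDatum`) to glue the rescaled flights of a one-shift datum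
into a DSS blow-up orbit: the floor characterisation of the flight containing `t < t⋆`, how the
phase maps `t ↦ t⋆ - e^{∓T}(t⋆ - t)` move flights and preserve local time, the local length `τ`
of every flight when `τ = t⋆(1 - e^{-T})`, `e^{jT}λ^{-j} = e^{-j log g}`, `(g^j)⁻¹ = e^{-j log g}`,
and the affine reparametrisation of a one-sided derivative.  MODEL-lattice support only; nothing
here concerns the Navier–Stokes equations.
-/

noncomputable section

-- `Summit.NavierStokesRegularity.NavierStokesRegularity.…` is the tree's (summit = problem) namespace; the
-- duplicated component is intended, so the dupNamespace linter is silenced for this file.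
set_option linter.dupNamespace false

namespace Summit.NavierStokesRegularity.NavierStokesRegularity.Theorems

namespace DSSOneShift

open Filter Topology Set

/-! ## Flight bookkeeping: `t_j = t⋆ - t⋆e^{-jT}`, local time `e^{jT}(t - t_j)`, index `⌊log(t⋆/(t⋆-t))/T⌋` -/

/-- Floor characterisation of the flight index: for `t < t⋆`,
`⌊log(t⋆/(t⋆-t))/T⌋ = j ↔ t_j ≤ t < t_{j+1}`. [folklore] -/
theorem floor_flight_iff {T tstar t : ℝ} (hT : 0 < T) (htstar : 0 < tstar) (ht : t < tstar)
    (j : ℤ) :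
    ⌊Real.log (tstar / (tstar - t)) / T⌋ = j ↔
      tstar - tstar * Real.exp (-((j : ℝ) * T)) ≤ t ∧
        t < tstar - tstar * Real.exp (-(((j : ℝ) + 1) * T)) := by
  have hst : 0 < tstar - t := sub_pos.2 ht
  have hq : 0 < tstar / (tstar - t) := div_pos htstar hst
  rw [Int.floor_eq_iff, le_div_iff₀ hT, div_lt_iff₀ hT, Real.le_log_iff_exp_le hq,
    Real.log_lt_iff_lt_exp hq, le_div_iff₀ hst, div_lt_iff₀ hst, Real.exp_neg, Real.exp_neg]
  have he1 : 0 < Real.exp ((j : ℝ) * T) := Real.exp_pos _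
  have he2 : 0 < Real.exp (((j : ℝ) + 1) * T) := Real.exp_pos _
  constructor
  · rintro ⟨h1, h2⟩
    constructor
    · have : tstar - t ≤ tstar * (Real.exp ((j : ℝ) * T))⁻¹ := by
        rw [← div_eq_mul_inv, le_div_iff₀ he1]; linarith
      linarith
    · have : tstar * (Real.exp (((j : ℝ) + 1) * T))⁻¹ < tstar - t := by
        rw [← div_eq_mul_inv, div_lt_iff₀ he2]; linarith
      linarith
  · rintro ⟨h1, h2⟩
    constructor
    · have : tstar - t ≤ tstar * (Real.exp ((j : ℝ) * T))⁻¹ := by linarith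
      rw [← div_eq_mul_inv, le_div_iff₀ he1] at this; linarith
    · have : tstar * (Real.exp (((j : ℝ) + 1) * T))⁻¹ < tstar - t := by linarith
      rw [← div_eq_mul_inv, div_lt_iff₀ he2] at this; linarith

/-- The forward phase map `t ↦ t⋆ - e^{-T}(t⋆ - t)` moves flight `j` to flight `j+1`. [folklore] -/
theorem flight_succ {T tstar t : ℝ} (j : ℤ)
    (h1 : tstar - tstar * Real.exp (-((j : ℝ) * T)) ≤ t)
    (h2 : t < tstar - tstar * Real.exp (-(((j : ℝ) + 1) * T))) :
    tstar - tstar * Real.exp (-((((j + 1 : ℤ) : ℝ)) * T)) ≤ tstar - Real.exp (-T) * (tstar - t) ∧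
      tstar - Real.exp (-T) * (tstar - t)
        < tstar - tstar * Real.exp (-((((j + 1 : ℤ) : ℝ) + 1) * T)) := by
  have hE : 0 < Real.exp (-T) := Real.exp_pos _
  have e1 : Real.exp (-((((j + 1 : ℤ) : ℝ)) * T)) = Real.exp (-T) * Real.exp (-((j : ℝ) * T)) := by
    rw [← Real.exp_add]; push_cast; ring_nf
  have e2 : Real.exp (-((((j + 1 : ℤ) : ℝ) + 1) * T))
      = Real.exp (-T) * Real.exp (-(((j : ℝ) + 1) * T)) := by
    rw [← Real.exp_add]; push_cast; ring_nf
  rw [e1, e2]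
  constructor <;> nlinarith [mul_le_mul_of_nonneg_left h1 hE.le, mul_lt_mul_of_pos_left h2 hE]

/-- The backward phase map `t ↦ t⋆ - e^{T}(t⋆ - t)` moves flight `j` to flight `j-1`. [folklore] -/
theorem flight_pred {T tstar t : ℝ} (j : ℤ)
    (h1 : tstar - tstar * Real.exp (-((j : ℝ) * T)) ≤ t)
    (h2 : t < tstar - tstar * Real.exp (-(((j : ℝ) + 1) * T))) :
    tstar - tstar * Real.exp (-((((j - 1 : ℤ) : ℝ)) * T)) ≤ tstar - Real.exp T * (tstar - t) ∧
      tstar - Real.exp T * (tstar - t)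
        < tstar - tstar * Real.exp (-((((j - 1 : ℤ) : ℝ) + 1) * T)) := by
  have hE : 0 < Real.exp T := Real.exp_pos _
  have e1 : Real.exp (-((((j - 1 : ℤ) : ℝ)) * T)) = Real.exp T * Real.exp (-((j : ℝ) * T)) := by
    rw [← Real.exp_add]; push_cast; ring_nf
  have e2 : Real.exp (-((((j - 1 : ℤ) : ℝ) + 1) * T))
      = Real.exp T * Real.exp (-(((j : ℝ) + 1) * T)) := by
    rw [← Real.exp_add]; push_cast; ring_nf
  rw [e1, e2]
  constructor <;> nlinarith [mul_le_mul_of_nonneg_left h1 hE.le, mul_lt_mul_of_pos_left h2 hE]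

/-- Local time is preserved by the forward phase map. [folklore] -/
theorem loc_succ {T tstar t : ℝ} (j : ℤ) :
    Real.exp ((((j + 1 : ℤ) : ℝ)) * T)
        * (tstar - Real.exp (-T) * (tstar - t) - (tstar - tstar * Real.exp (-((((j + 1 : ℤ) : ℝ)) * T))))
      = Real.exp ((j : ℝ) * T) * (t - (tstar - tstar * Real.exp (-((j : ℝ) * T)))) := by
  have e1 : Real.exp ((((j + 1 : ℤ) : ℝ)) * T) = Real.exp ((j : ℝ) * T) * Real.exp T := by
    rw [← Real.exp_add]; push_cast; ring_nf
  have e2 : Real.exp (-((((j + 1 : ℤ) : ℝ)) * T)) = Real.exp (-((j : ℝ) * T)) * Real.exp (-T) := by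
    rw [← Real.exp_add]; push_cast; ring_nf
  rw [e1, e2]
  have h3 : Real.exp T * Real.exp (-T) = 1 := by rw [← Real.exp_add, add_neg_cancel, Real.exp_zero]
  linear_combination (Real.exp ((j : ℝ) * T) * (t - tstar + tstar * Real.exp (-((j : ℝ) * T)))) * h3

/-- Local time is preserved by the backward phase map. [folklore] -/
theorem loc_pred {T tstar t : ℝ} (j : ℤ) :
    Real.exp ((((j - 1 : ℤ) : ℝ)) * T)
        * (tstar - Real.exp T * (tstar - t) - (tstar - tstar * Real.exp (-((((j - 1 : ℤ) : ℝ)) * T))))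
      = Real.exp ((j : ℝ) * T) * (t - (tstar - tstar * Real.exp (-((j : ℝ) * T)))) := by
  have e1 : Real.exp ((((j - 1 : ℤ) : ℝ)) * T) = Real.exp ((j : ℝ) * T) * Real.exp (-T) := by
    rw [← Real.exp_add]; push_cast; ring_nf
  have e2 : Real.exp (-((((j - 1 : ℤ) : ℝ)) * T)) = Real.exp (-((j : ℝ) * T)) * Real.exp T := by
    rw [← Real.exp_add]; push_cast; ring_nf
  rw [e1, e2]
  have h3 : Real.exp T * Real.exp (-T) = 1 := by rw [← Real.exp_add, add_neg_cancel, Real.exp_zero]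
  linear_combination (Real.exp ((j : ℝ) * T) * (t - tstar + tstar * Real.exp (-((j : ℝ) * T)))) * h3

/-- Flight `j` has local length `τ`: `e^{jT}(t_{j+1} - t_j) = τ` when `τ = t⋆(1 - e^{-T})`. [folklore] -/
theorem loc_end {T tstar τ : ℝ} (hτ : τ = tstar * (1 - Real.exp (-T))) (j : ℤ) :
    Real.exp ((j : ℝ) * T)
        * (tstar - tstar * Real.exp (-(((j : ℝ) + 1) * T)) - (tstar - tstar * Real.exp (-((j : ℝ) * T))))
      = τ := by
  have e2 : Real.exp (-(((j : ℝ) + 1) * T)) = Real.exp (-((j : ℝ) * T)) * Real.exp (-T) := by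
    rw [← Real.exp_add]; ring_nf
  have h3 : Real.exp ((j : ℝ) * T) * Real.exp (-((j : ℝ) * T)) = 1 := by
    rw [← Real.exp_add, add_neg_cancel, Real.exp_zero]
  rw [e2, hτ]
  linear_combination (tstar * (1 - Real.exp (-T))) * h3

/-- The point of flight `j` with local time `s`: `e^{jT}((t_j + e^{-jT}s) - t_j) = s`. [folklore] -/
theorem loc_of_local {T tstar s : ℝ} (j : ℤ) :
    Real.exp ((j : ℝ) * T) * (tstar - tstar * Real.exp (-((j : ℝ) * T)) + Real.exp (-((j : ℝ) * T)) * s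
        - (tstar - tstar * Real.exp (-((j : ℝ) * T)))) = s := by
  have h3 : Real.exp ((j : ℝ) * T) * Real.exp (-((j : ℝ) * T)) = 1 := by
    rw [← Real.exp_add, add_neg_cancel, Real.exp_zero]
  linear_combination s * h3

/-! ## Scalar identities of the rescaling (`λ = g e^{T}`, amplitudes `g^{-j} = e^{-j log g}`) -/

/-- `e^{jT} · λ^{-j} = e^{-j log g}` for `λ = g e^{T}`, `g > 0`. [folklore] -/
theorem exp_mul_zpow_neg {lam g T : ℝ} (hg : 0 < g) (hlam : lam = g * Real.exp T) (j : ℤ) :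
    Real.exp ((j : ℝ) * T) * lam ^ (-j) = Real.exp (-((j : ℝ) * Real.log g)) := by
  have hl : lam = Real.exp (Real.log g + T) := by rw [Real.exp_add, Real.exp_log hg, hlam]
  rw [hl, ← Real.rpow_intCast, ← Real.exp_mul, ← Real.exp_add]
  push_cast
  ring_nf

/-- `(g^j)⁻¹ = e^{-j log g}` for `g > 0`. [folklore] -/
theorem zpow_inv_eq_exp {g : ℝ} (hg : 0 < g) (j : ℤ) :
    (g ^ j)⁻¹ = Real.exp (-((j : ℝ) * Real.log g)) := by
  conv_lhs => rw [← Real.exp_log hg]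
  rw [← Real.rpow_intCast, ← Real.exp_mul, ← Real.exp_neg]
  ring_nf

/-- Affine reparametrisation of a one-sided derivative: if `f` has derivative `f'` within `S'` at
`c(t-d)` and `x ↦ c(x-d)` maps `S` into `S'`, then `x ↦ a • f(c(x-d))` has derivative `a • c • f'`
within `S` at `t`. [folklore] -/
theorem hasDerivWithinAt_affine {V : Type*} [NormedAddCommGroup V] [NormedSpace ℝ V]
    {f : ℝ → V} {f' : V} {a c d t : ℝ} {S S' : Set ℝ}
    (hf : HasDerivWithinAt f f' S' (c * (t - d))) (hmaps : MapsTo (fun x => c * (x - d)) S S') :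
    HasDerivWithinAt (fun x => a • f (c * (x - d))) (a • c • f') S t := by
  have hh : HasDerivWithinAt (fun x => c * (x - d)) c S t := by
    simpa using (((hasDerivAt_id t).sub_const d).const_mul c).hasDerivWithinAt
  exact (hf.scomp t hh hmaps).const_smul a

end DSSOneShift

end Summit.NavierStokesRegularity.NavierStokesRegularity.Theorems
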